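/-
Copyright (c) 2026 the pub-hodgecm-mathlib formalisation cell (harness21).  Prover seat hodgecm-mathlib-K2E3-p37 (g3), Track B «K2-LIT»,
#184♮ = hLiu418 = `stmt-HodgeConjecture-24832`; socket #41, KIND W, (iii-fin) row (KW-fin-stab), pole (R): FILE 2b of K2E3-p06 (g7)'s ARCHITECT NOTE #1 (K2 bus
2026-09-05 01:33:21Z; KW desk F0P2-p08 (g4) deal 01:38:02Z) — the two radius letters `hsup`, `hinv` of 📤 p864173 `K2LiuBadPlaceWhittakerFarShellsRadii.setIntegral_farShell_eq_zero_of_radii`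
with EXPLICIT radii at EVERY place.  THEOREMS ONLY (no `def`, no `instance`, no notation, no named-fact hypothesis, no `sorry`); lane `--supports stmt-HodgeConjecture-24832`.
-/
import Summits.HodgeConjecture.HodgeConjecture.Theorems.K2LiuGoodPlaceLeviSupply       -- ★ U1-supply at GOOD places (radius 1): `inv_one_add_smul`, `one_apply_eval`, `valuation_toPlace_uniformizer_lt_one`, `valBound_of_mball_one`, `mball_zero_of_forall_valBound`, `mball_one_of_forall_valBound`, `norm_eq_one_of_v_eq_one` (+ ★ F3a `exists_leviElem`∕`leviD_inv_one_add_smul`, ★ F3c-1 balls, ★ Lit `isUnit_det_and_valBound_inv`, ★ bridge, ★ `map_nonsing_inv_of_isUnit`)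
import Mathlib.LinearAlgebra.Matrix.Transvection
import HarnessLib

/-!
# Crux `HLiu418`, socket #41, KIND W, (KW-fin-stab) FILE 2b — `K2LiuLocalLeviSupplyExplicit`: ★ F3a's SUPPLY OF SIEGEL–LEVI MOVES `m(1 + ẑu)` WITH EXPLICIT RADII
# (`χ_det = 1 = |det_Δ|` as soon as `ord_v z ≥ 1 + Σ_{w∣v} f(χ_w)`; the inverses `(1+ẑu)⁻¹`, `(1+ẑu′)⁻¹` integral as soon as `ord_v z ≥ 2|b_T| + 1`), EVERY place, dyadic included

Cell `hodgecm-mathlib`, crux item hLiu418 = `stmt-HodgeConjecture-24832` (helper lane `--supports … --as helper`, count-neutral), route of record `HCCMUnconditional`;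
squad K2 ∕ K2Liu, road `K2_Liu`, socket #41 `sig_K2LiuSiegelEisensteinContinuation`, KIND W, (iii-fin) row, pole (R).  THE FINDING (K2E3-p06 (g7), ARCHITECT NOTE #1): the
(iii-fin) size letter needs Karel's radius with every constant an explicit finite-support function of the place; ★ F3a `K2LiuLocalLeviSupply.exists_ball_levi_supply`'s radius
`j₀` (the Siegel–Levi moves `m(1 + ẑu)` with `χ_v(det_Δ) = 1 = |det_Δ|_v`) and ★ F4b-1's `j₁` (integrality of `(1 + ẑu)⁻¹`, `(1 + ẑu′)⁻¹`) are `∃`'s by continuity, opaque per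
place.  📤 p864173 `setIntegral_farShell_eq_zero_of_radii` therefore takes them BY VALUE as `(j₀, hsup)`, `(j₁, hinv)`.  THIS FILE pays both letters ALGEBRAICALLY with explicit
thresholds, in the generic GR91 local frame `(F, E, c, δ, v, n, T₀, JD)` of ★ F3a (carriers `R = E ⊗ F_v = LocalRing E v = ∏_{w∣v} E_w`, `σ = conjLocal`, `T = gramS`, `ẑ = toLocalRing z`):
* §1 **inverting `1 + X` for `X ∈ ball(1)`** (`|X_{ab,w}| ≤ |ι_w π|` at every `w ∣ v`): `inv_one_add_of_mball_one` — `det(1+X)` is a unit, `(1+X)⁻¹ ∈ ball 0`,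
  `(1+X)⁻¹ − 1 ∈ ball 1` (★ U1-supply `K2LiuGoodPlaceLeviSupply.inv_one_add_smul`'s proof for a general `X`: place by place ★ Lit `isUnit_det_and_valBound_inv`, glued by
  `Pi.isUnit_iff` and ★ `map_nonsing_inv_of_isUnit`); `inv_one_add_of_mball` — the same for `X ∈ ball(j)`, `1 ≤ j`.
* §2 the directions of ★ F4b-1: `single a b e ∈ ball 0` (`|e|_w ≤ 1`), `T⁻¹σ(u)ᵀT ∈ ball(−2|b_T|)` for `u ∈ ball 0`; `det (1 + single a b t) = if a = b then 1 + t else 1`.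
* §3 HEAD **`hinv_of_radius`** — the letter `hinv` of 📤 p864173 VERBATIM for every radius `j₁` with `2|b_T| + 1 ≤ j₁` (letters `hεint hTb hTib` only).
* §4 HEAD **`hsup_of_radius`** — the letter `hsup` of 📤 p864173 VERBATIM for every radius `j₀` with `1 + Σ_{w∣v} cχ w ≤ j₀`, from the integrality of `ε` and a BY-VALUE conductor
  letter `hχc : ∀ w x (hx : IsUnit x), |x − 1|_w ≤ |ϖ_w|^{cχ w} → |x|_w = 1 → χ_w(x) = 1` (`cχ = f(χ_w)`, `= 0` iff unramified): `A := 1 + ẑ•single a b e` has `det A ∈ {1, 1 + ẑe}`,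
  so `|det A − 1|_{w′} ≤ |ι_{w′}π|^{j₀} < 1` at every `w′`; `q := m(A)` (★ `exists_leviElem`), `(blkD)⁻¹ = 1 + ẑ•(T⁻¹σ(u)ᵀT)` (★ `leviD_inv_one_add_smul`),
  `det(blkD) = det(T⁻¹σ(A⁻¹)ᵀT) = σ(det A⁻¹)` whose `w`-component has `|·|_w = |det A⁻¹|_{c⁻¹w} = 1` and `|· − 1|_w = |det A − 1|_{c⁻¹w} ≤ |ι π|^{cχ w} ≤ |ϖ_w|^{cχ w}`
  (★ `conjLocal_apply`, ★ `valued_galAdicCompletionMap`, ★ `valued_toPlace_uniformizer_le`), whence `chiDet (w_Δ q w_Δ) = 1` (★ `detDelta_weylDelta_conj`) and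
  `absDetDelta (w_Δ q w_Δ) = 1`.
[Casselman1980, §3] [HarrisKudlaSweet1996, §1 (1.11)–(1.12)] [PlatonovRapinchuk1994, §5.1] [TateThesis1967, §2.3] [CasselsFrohlichANT1967, Ch. II §10, Ch. VII §1.1].
HONEST LABEL.  Count-neutral helper, closes no socket: `HC_CM` is proved only modulo the 7 printed citations (2 remaining named inputs: hLiu418 = `stmt-HodgeConjecture-24832`,
h413 = `stmt-HodgeConjecture-24833`) until rung 0 closes.  NOT HERE: the level membership of the moves (★ p864100 `levi_apply_mem_congruenceGL_pow`, `M + 2b_T + c₂ ≤ j`) and the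
closed head of (KW-fin-stab) (K2E3-p06).

## References
* [Casselman1980] W. Casselman, *The unramified principal series of p-adic groups I*, Compositio Math. 40 (1980): §3.
* [HarrisKudlaSweet1996] M. Harris, S. Kudla, W. J. Sweet, *Theta dichotomy for unitary groups*, J. AMS 9 (1996): §1 (1.11)–(1.12).
* [PlatonovRapinchuk1994] V. Platonov, A. Rapinchuk, *Algebraic Groups and Number Theory* (1994): §5.1 (principal congruence subgroups).
* [TateThesis1967] J. Tate, in Cassels–Fröhlich (1967): §2.3 (the conductor of a quasi-character).
* [CasselsFrohlichANT1967] J. W. S. Cassels, A. Fröhlich (eds.), *Algebraic Number Theory* (1967): Ch. II §10, Ch. VII §1.1.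
-/

set_option autoImplicit false
set_option linter.dupNamespace false -- the mandated namespace repeats `HodgeConjecture.HodgeConjecture`

noncomputable section

open NumberField IsDedekindDomain Matrix
open scoped ValuativeRel MatrixGroups
open Literature.NumberTheory.Automorphic Literature.NumberTheory.Automorphic.UnitaryGroup
open Literature.NumberTheory.GelbartRogawski1991 Literature.NumberTheory.GelbartRogawski1991.AdaptedBlocks
open Literature.NumberTheory.GelbartRogawski1991.UnitaryDualPair Literature.NumberTheory.GelbartRogawski1991.UnitaryDualPair.LocalSplitting
open Literature.NumberTheory.K2Lit.LocalSiegelDoubled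
open Summit.HodgeConjecture.HodgeConjecture.Cruxes.HLiu418.K2LiuSiegelLeviWeylAlgebra
open Summit.HodgeConjecture.HodgeConjecture.Cruxes.HLiu418.K2LiuLocalLeviSupply (exists_leviElem leviD_inv_one_add_smul)
open Summit.HodgeConjecture.HodgeConjecture.Cruxes.HLiu418.K2LiuLocalRingValuationBalls
open Summit.HodgeConjecture.HodgeConjecture.Cruxes.HLiu418.K2LiuSiegelWeylUnipotentIwasawa (map_nonsing_inv_of_isUnit)
open Summit.HodgeConjecture.HodgeConjecture.Cruxes.HLiu418.K2LiuGoodPlaceLeviSupply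
  (inv_one_add_smul one_apply_eval valuation_toPlace_uniformizer_lt_one valBound_of_mball_one mball_zero_of_forall_valBound mball_one_of_forall_valBound norm_eq_one_of_v_eq_one)

namespace Summit.HodgeConjecture.HodgeConjecture.Cruxes.HLiu418.K2LiuLocalLeviSupplyExplicit

variable (F : Type) [Field F] [NumberField F] (E : Type) [Field E] [NumberField E] [Algebra F E]
  [Algebra.IsQuadraticExtension F E] (c : E ≃ₐ[F] E)
  {δ : E} (hcδ : c δ = -δ) (hδ : δ ≠ 0) {dd : F} (hd : δ * δ = algebraMap F E dd)
  (v : HeightOneSpectrum (𝓞 F)) (n : ℕ) {T₀ : Matrix (Fin n) (Fin n) F} (hT₀ : T₀.IsSymm) (hT₀d : IsUnit T₀.det)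
  {JD : Matrix (Fin (n + n)) (Fin (n + n)) E} (hJD : JD = (gramD F n T₀).map (algebraMap F E))
  {π : v.adicCompletion F} (hπ : Valued.v π = WithZero.exp (-1 : ℤ))

/-! ## §1 Inverting `1 + X` for `X ∈ ball(1)` (and `ball(j)`, `1 ≤ j`), at every place -/

section Invert

variable {m : Type*} [Fintype m] [DecidableEq m]

omit [Algebra.IsQuadraticExtension F E] in
include hπ in
/-- **`(1 + X)⁻¹` for `X ∈ ball(1)`**: `det(1 + X)` is a unit of `E ⊗ F_v`, `(1 + X)⁻¹ ∈ ball(0)` and `(1 + X)⁻¹ − 1 ∈ ball(1)` — ★ U1-supply `inv_one_add_smul`'s argument for a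
general `X` (reduce modulo `𝔪_w` at each `w ∣ v`: ★ Lit `isUnit_det_and_valBound_inv`; glue by `Pi.isUnit_iff`, ★ `map_nonsing_inv_of_isUnit`). [cite: PlatonovRapinchuk1994, §5.1] -/
theorem inv_one_add_of_mball_one {X : Matrix m m (LocalRing E v)}
    (hX : ∀ a b (w : PlacesOver E v), Valued.v (X a b w) ≤ Valued.v (toPlace v w π) ^ (1 : ℤ)) :
    IsUnit (1 + X).det ∧
      (∀ a b (w : PlacesOver E v), Valued.v ((1 + X)⁻¹ a b w) ≤ Valued.v (toPlace v w π) ^ (0 : ℤ)) ∧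
      (∀ a b (w : PlacesOver E v), Valued.v (((1 + X)⁻¹ - 1) a b w) ≤ Valued.v (toPlace v w π) ^ (1 : ℤ)) := by
  set A : Matrix m m (LocalRing E v) := 1 + X with hA
  set ev : ∀ w : PlacesOver E v, LocalRing E v →+* w.1.adicCompletion E := fun w => Pi.evalRingHom (fun w' : PlacesOver E v => w'.1.adicCompletion E) w
    with hev
  have hN : ∀ a b (w : PlacesOver E v), Valued.v ((A - 1) a b w) ≤ Valued.v (toPlace v w π) ^ (1 : ℤ) := by
    rw [hA, add_sub_cancel_left]
    exact hX
  have hVB : ∀ w : PlacesOver E v, ValBound (ValuativeRel.valuation (w.1.adicCompletion E) (toPlace v w π)) (A.map (ev w) - 1) := by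
    intro w a b
    have h := valBound_of_mball_one F E v hN w a b
    rw [Matrix.map_apply] at h
    rw [Matrix.sub_apply, Matrix.map_apply, ← one_apply_eval F E v a b w]
    exact h
  have hw : ∀ w : PlacesOver E v, IsUnit (A.map (ev w)).det ∧ ValBound 1 (A.map (ev w))⁻¹ ∧
      ValBound (ValuativeRel.valuation (w.1.adicCompletion E) (toPlace v w π)) ((A.map (ev w))⁻¹ - 1) := fun w =>
    isUnit_det_and_valBound_inv (hVB w) (valuation_toPlace_uniformizer_lt_one F E v hπ w)
  have hdet : IsUnit A.det := by
    rw [Pi.isUnit_iff]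
    intro w
    have h : A.det w = (A.map (ev w)).det := by
      rw [← RingHom.mapMatrix_apply, ← RingHom.map_det]; rfl
    rw [h]; exact (hw w).1
  have hinv : ∀ w : PlacesOver E v, A⁻¹.map (ev w) = (A.map (ev w))⁻¹ := fun w => map_nonsing_inv_of_isUnit (ev w) hdet
  refine ⟨hdet, mball_zero_of_forall_valBound F E v (fun w => ?_), mball_one_of_forall_valBound F E v (fun w => ?_)⟩
  · rw [hinv w]; exact (hw w).2.1
  · have h : (A⁻¹ - 1).map (ev w) = (A.map (ev w))⁻¹ - 1 := by
      rw [Matrix.map_sub _ (map_sub (ev w)), hinv w, Matrix.map_one _ (map_zero _) (map_one _)]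
    rw [h]; exact (hw w).2.2

omit [Algebra.IsQuadraticExtension F E] in
include hπ in
/-- the same for `X ∈ ball(j)`, `1 ≤ j` (`ball(j) ⊆ ball(1)`, ★ `mball_antitone`). [cite: PlatonovRapinchuk1994, §5.1] -/
theorem inv_one_add_of_mball {j : ℤ} (hj : 1 ≤ j) {X : Matrix m m (LocalRing E v)}
    (hX : ∀ a b (w : PlacesOver E v), Valued.v (X a b w) ≤ Valued.v (toPlace v w π) ^ j) :
    IsUnit (1 + X).det ∧
      (∀ a b (w : PlacesOver E v), Valued.v ((1 + X)⁻¹ a b w) ≤ Valued.v (toPlace v w π) ^ (0 : ℤ)) ∧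
      (∀ a b (w : PlacesOver E v), Valued.v (((1 + X)⁻¹ - 1) a b w) ≤ Valued.v (toPlace v w π) ^ (1 : ℤ)) :=
  inv_one_add_of_mball_one F E v hπ (mball_antitone F E v hπ hj hX)

end Invert

/-! ## §2 The directions `single a b e`, `T⁻¹σ(u)ᵀT`, and `det (1 + single a b t)` -/

section Directions

omit [Algebra.IsQuadraticExtension F E] in
/-- `single a b e ∈ ball 0` when `|e|_w ≤ 1` for all `w ∣ v`. [cite: CasselsFrohlichANT1967, Ch. II §10] -/
theorem mball_single {e : LocalRing E v} (he : ∀ w : PlacesOver E v, Valued.v (e w) ≤ 1) (a b : Fin n) :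
    ∀ a' b' (w : PlacesOver E v), Valued.v (Matrix.single a b e a' b' w) ≤ Valued.v (toPlace v w π) ^ (0 : ℤ) := fun a' b' w => by
  rw [zpow_zero, Matrix.single_apply]
  split_ifs
  · exact he w
  · rw [Pi.zero_apply, map_zero]
    exact zero_le

omit [NumberField F] [Algebra.IsQuadraticExtension F E] in
/-- the two directions of ★ F4b-1: `e := if bb then ε else 1` is integral when `ε` is. [cite: CasselsFrohlichANT1967, Ch. II §10] -/
theorem valued_dirScalar_le_one {ε : LocalRing E v} (hεint : ∀ w : PlacesOver E v, Valued.v (ε w) ≤ 1) (bb : Bool) :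
    ∀ w : PlacesOver E v, Valued.v ((if bb then ε else (1 : LocalRing E v)) w) ≤ 1 := fun w => by
  cases bb
  · have h : (if false = true then ε else (1 : LocalRing E v)) = 1 := if_neg Bool.false_ne_true
    rw [h, Pi.one_apply, map_one]
  · have h : (if true = true then ε else (1 : LocalRing E v)) = ε := if_pos rfl
    rw [h]
    exact hεint w

omit [Algebra.IsQuadraticExtension F E] in
include hπ in
/-- `T⁻¹σ(u)ᵀT ∈ ball(−2|b_T|)` for `u ∈ ball 0`, `T`, `T⁻¹ ∈ ball(−b_T)` (★ `mball_mul`, ★ `mball_conjTranspose`). [cite: CasselsFrohlichANT1967, Ch. II §10] -/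
theorem mball_leviDir {bT : ℤ}
    (hTb : ∀ i j (w : PlacesOver E v), Valued.v (gramS F E v n T₀ i j w) ≤ Valued.v (toPlace v w π) ^ (-bT))
    (hTib : ∀ i j (w : PlacesOver E v), Valued.v ((gramS F E v n T₀)⁻¹ i j w) ≤ Valued.v (toPlace v w π) ^ (-bT))
    {u : Matrix (Fin n) (Fin n) (LocalRing E v)} (hu : ∀ a b (w : PlacesOver E v), Valued.v (u a b w) ≤ Valued.v (toPlace v w π) ^ (0 : ℤ)) :
    ∀ a b (w : PlacesOver E v), Valued.v (((gramS F E v n T₀)⁻¹ * (u.map (conjLocal E c v))ᵀ * gramS F E v n T₀) a b w) ≤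
      Valued.v (toPlace v w π) ^ (-(2 * |bT|)) := by
  have h1 := mball_mul F E v hπ (mball_antitone F E v hπ (show -|bT| ≤ -bT by have := le_abs_self bT; omega) hTib) (mball_conjTranspose F E c v hu)
  have h2 := mball_mul F E v hπ h1 (mball_antitone F E v hπ (show -|bT| ≤ -bT by have := le_abs_self bT; omega) hTb)
  exact mball_antitone F E v hπ (by omega) h2

/-- **`det (1 + single a b t) = 1 + t` on the diagonal, `= 1` off it** (a transvection, Mathlib `det_transvection_of_ne`). [folklore] -/
theorem det_one_add_single {R : Type*} [CommRing R] {m : Type*} [Fintype m] [DecidableEq m] (a b : m) (t : R) :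
    (1 + Matrix.single a b t).det = if a = b then 1 + t else 1 := by
  split_ifs with hab
  · subst hab
    have h : (1 : Matrix m m R) + Matrix.single a a t = Matrix.diagonal (fun k => if k = a then 1 + t else 1) := by
      ext k l
      rw [Matrix.add_apply, Matrix.diagonal_apply, Matrix.one_apply, Matrix.single_apply]
      by_cases hkl : k = l
      · subst hkl
        by_cases hka : k = a
        · subst hka
          rw [if_pos rfl, if_pos ⟨rfl, rfl⟩, if_pos rfl, if_pos rfl]
        · rw [if_pos rfl, if_neg (fun h => hka h.1.symm), if_pos rfl, if_neg hka, add_zero]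
      · rw [if_neg hkl, if_neg (fun h => hkl (h.1.symm.trans h.2)), if_neg hkl, add_zero]
    rw [h, Matrix.det_diagonal, Finset.prod_ite_eq' Finset.univ a (fun _ => 1 + t)]
    simp only [Finset.mem_univ, if_true]
  · exact Matrix.det_transvection_of_ne a b hab t

omit [Algebra.IsQuadraticExtension F E] in
/-- **σ-transport of valuations**: `|(σ r)_w| = |r_{c⁻¹w}|` for `σ = c ⊗ 1 = conjLocal` (★ `conjLocal_apply`, ★ `valued_galAdicCompletionMap`; exported for the closed head's
`cχ ∘ c⁻¹` bookkeeping). [cite: CasselsFrohlichANT1967, Ch. VII §1.1] -/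
theorem valued_conjLocal_apply (r : LocalRing E v) (w : PlacesOver E v) :
    Valued.v (conjLocal E c v r w) = Valued.v (r ⟨c⁻¹ • w.1, under_inv_smul_eq c w⟩) := by
  rw [conjLocal_apply, valued_galAdicCompletionMap]

end Directions

/-! ## §3 HEAD A: the integrality letter `hinv` of 📤 p864173 for every radius `j₁ ≥ 2|b_T| + 1` -/

omit [Algebra.IsQuadraticExtension F E] in
include hπ in
/-- **THE LETTER `hinv` OF `setIntegral_farShell_eq_zero_of_radii`, EXPLICIT RADIUS**: for `ε` integral, `T = gramS`, `T⁻¹ ∈ ball(−b_T)` and every `j₁` with `2|b_T| + 1 ≤ j₁`: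
for all directions `u = single a b e` (`e = if bb then ε else 1`) and all `z ∈ 𝔭_v^{j₁}`, the inverses `(1 + ẑu)⁻¹` and `(1 + ẑ·(T⁻¹σ(u)ᵀT))⁻¹` lie in `ball(0)` (`ẑu ∈ ball(j₁) ⊆ ball(1)`,
`ẑ·T⁻¹σ(u)ᵀT ∈ ball(j₁ − 2|b_T|) ⊆ ball(1)`, §1). [cite: PlatonovRapinchuk1994, §5.1] [cite: Casselman1980, §3] -/
theorem hinv_of_radius {ε : LocalRing E v} (hεint : ∀ w : PlacesOver E v, Valued.v (ε w) ≤ 1) {bT : ℤ}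
    (hTb : ∀ i j (w : PlacesOver E v), Valued.v (gramS F E v n T₀ i j w) ≤ Valued.v (toPlace v w π) ^ (-bT))
    (hTib : ∀ i j (w : PlacesOver E v), Valued.v ((gramS F E v n T₀)⁻¹ i j w) ≤ Valued.v (toPlace v w π) ^ (-bT))
    {j₁ : ℤ} (hj₁ : 2 * |bT| + 1 ≤ j₁) :
    ∀ (a b : Fin n) (bb : Bool), ∀ z ∈ primePowBall (v.adicCompletion F) j₁,
      (∀ a' b' (w : PlacesOver E v), Valued.v ((1 + toLocalRing E v z • Matrix.single a b (if bb then ε else (1 : LocalRing E v)))⁻¹ a' b' w) ≤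
        Valued.v (toPlace v w π) ^ (0 : ℤ)) ∧
      (∀ a' b' (w : PlacesOver E v), Valued.v ((1 + toLocalRing E v z •
        ((gramS F E v n T₀)⁻¹ * ((Matrix.single a b (if bb then ε else (1 : LocalRing E v))).map (conjLocal E c v))ᵀ * gramS F E v n T₀))⁻¹ a' b' w) ≤
        Valued.v (toPlace v w π) ^ (0 : ℤ)) := by
  intro a b bb z hz
  have hu := mball_single F E v n (π := π) (valued_dirScalar_le_one F E v hεint bb) a b
  have habs : 0 ≤ |bT| := abs_nonneg bT
  have hX := mball_antitone F E v hπ (show (1 : ℤ) ≤ j₁ + 0 by omega) (mball_smul F E v hπ hz hu)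
  have hY := mball_antitone F E v hπ (show (1 : ℤ) ≤ j₁ + -(2 * |bT|) by omega) (mball_smul F E v hπ hz (mball_leviDir F E c v n hπ hTb hTib hu))
  exact ⟨(inv_one_add_of_mball_one F E v hπ hX).2.1, (inv_one_add_of_mball_one F E v hπ hY).2.1⟩

/-! ## §4 HEAD B: the Levi-supply letter `hsup` of 📤 p864173 for every radius `j₀ ≥ 1 + Σ_{w∣v} cχ w` -/

include hcδ hδ hd hT₀ hT₀d hJD hπ in
/-- **THE LETTER `hsup` OF `setIntegral_farShell_eq_zero_of_radii`, EXPLICIT RADIUS** (★ F3a's supply, algebraically).  Let `ε ∈ E ⊗ F_v` be integral, `χ_w : E_wˣ →* ℂˣ` characters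
with a BY-VALUE conductor letter `hχc` at exponents `cχ w` for uniformisers `ϖ_w` (`|x − 1|_w ≤ |ϖ_w|^{cχ w}`, `|x|_w = 1` ⟹ `χ_w(x) = 1`), and `j₀` with `1 + Σ_{w∣v} cχ w ≤ j₀`.
THEN for all directions `u = single a b e` (`e = if bb then ε else 1`) and all `z ∈ 𝔭_v^{j₀}` there is a Siegel–Levi `q ∈ H(F_v)` (`blkC = blkB = 0`) with `blkA = 1 + ẑu`,
`(blkD)⁻¹ = 1 + ẑ·(T⁻¹σ(u)ᵀT)`, `χ_v(det_Δ(w_Δ q w_Δ)) = 1` and `|det_Δ(w_Δ q w_Δ)|_v = 1`.  PROOF: `A := 1 + ẑu` has `det A = 1 + ẑe` (`a = b`) or `1`, so at every `w′`: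
`|det A|_{w′} = 1`, `|det A − 1|_{w′} ≤ |ι_{w′}π|^{j₀}`; `q := m(A)` (★ `exists_leviElem`, `A⁻¹` from §1); `det(blkD) = det(T⁻¹σ(A⁻¹)ᵀT) = σ(det A⁻¹)`, and at `w`:
`|σ(det A⁻¹)_w| = |det A⁻¹|_{c⁻¹w} = 1`, `|σ(det A⁻¹)_w − 1| = |det A − 1|_{c⁻¹w} ≤ |ι π|^{cχ w} ≤ |ϖ_w|^{cχ w}` ⟹ `hχc`; norms from valuations.
[cite: Casselman1980, §3] [cite: HarrisKudlaSweet1996, §1 (1.11)–(1.12)] [cite: TateThesis1967, §2.3] [cite: CasselsFrohlichANT1967, Ch. VII §1.1] -/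
theorem hsup_of_radius {ε : LocalRing E v} (hεint : ∀ w : PlacesOver E v, Valued.v (ε w) ≤ 1)
    (χv : ∀ w : PlacesOver E v, (w.1.adicCompletion E)ˣ →* ℂˣ)
    {ϖ : (w : PlacesOver E v) → w.1.adicCompletion E} (hϖ : ∀ w, Valued.v (ϖ w) = WithZero.exp (-1 : ℤ)) (cχ : PlacesOver E v → ℕ)
    (hχc : ∀ (w : PlacesOver E v) (x : w.1.adicCompletion E) (hx : IsUnit x),
      Valued.v (x - 1) ≤ Valued.v (ϖ w) ^ cχ w → Valued.v x = 1 → χv w hx.unit = 1)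
    {j₀ : ℤ} (hj₀ : 1 + ∑ w : PlacesOver E v, (cχ w : ℤ) ≤ j₀) :
    ∀ (a b : Fin n) (bb : Bool), ∀ z ∈ primePowBall (v.adicCompletion F) j₀, ∃ q : UnitaryGroup.localPi E c (n + n) JD v,
      blkC (matA F E c v n q) = 0 ∧ blkB (matA F E c v n q) = 0 ∧
      blkA (matA F E c v n q) = 1 + toLocalRing E v z • Matrix.single a b (if bb then ε else (1 : LocalRing E v)) ∧
      (blkD (matA F E c v n q))⁻¹ = 1 + toLocalRing E v z •
        ((gramS F E v n T₀)⁻¹ * ((Matrix.single a b (if bb then ε else (1 : LocalRing E v))).map (conjLocal E c v))ᵀ * gramS F E v n T₀) ∧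
      chiDet F E c v n χv (weylDelta F E c v n hJD * q * weylDelta F E c v n hJD) = 1 ∧
      absDetDelta F E c v n (weylDelta F E c v n hJD * q * weylDelta F E c v n hJD) = 1 := by
  intro a b bb z hz
  have hT : IsUnit (gramS F E v n T₀).det := isUnit_det_gramS' F E v n hT₀d
  have hsum : ∀ w : PlacesOver E v, (cχ w : ℤ) ≤ ∑ w' : PlacesOver E v, (cχ w' : ℤ) := fun w =>
    Finset.single_le_sum (f := fun w' : PlacesOver E v => (cχ w' : ℤ)) (fun w' _ => Int.natCast_nonneg (cχ w')) (Finset.mem_univ w)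
  have hj1 : (1 : ℤ) ≤ j₀ := by
    have h0 : (0 : ℤ) ≤ ∑ w' : PlacesOver E v, (cχ w' : ℤ) := Finset.sum_nonneg fun w' _ => Int.natCast_nonneg (cχ w')
    omega
  -- the direction scalar `e`, the matrix `A = 1 + ẑ•single a b e` and its inverse (§1)
  obtain ⟨e, he⟩ : ∃ e : LocalRing E v, e = (if bb then ε else (1 : LocalRing E v)) := ⟨_, rfl⟩
  rw [← he]
  have he1 : ∀ w : PlacesOver E v, Valued.v (e w) ≤ 1 := by
    rw [he]; exact valued_dirScalar_le_one F E v hεint bb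
  have he0 : ∀ w : PlacesOver E v, Valued.v (e w) ≤ Valued.v (toPlace v w π) ^ (0 : ℤ) := fun w => by
    rw [zpow_zero]; exact he1 w
  have hu := mball_single F E v n (π := π) he1 a b
  have hX := mball_antitone F E v hπ (show (1 : ℤ) ≤ j₀ + 0 by omega) (mball_smul F E v hπ hz hu)
  obtain ⟨hdet, -, -⟩ := inv_one_add_of_mball_one F E v hπ hX
  have hA'A := Matrix.nonsing_inv_mul _ hdet
  have hAA' := Matrix.mul_nonsing_inv _ hdet
  obtain ⟨q, hC, hB, hAq, hDq, hDinv, -⟩ := exists_leviElem F E c hcδ hδ hd v n hT₀ hT₀d hJD hA'A hAA'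
  -- `det A = 1 + ẑe` on the diagonal direction, `= 1` off it: valuation `1` and `≡ 1` within `|ι π|^{j₀}` at EVERY place
  have hze : ∀ w : PlacesOver E v, Valued.v ((toLocalRing E v z * e) w) ≤ Valued.v (toPlace v w π) ^ j₀ := by
    have h := ball_mul F E v hπ (ball_toLocalRing_of_mem_primePowBall F E v hπ hz) he0
    rw [add_zero] at h
    exact h
  have hlt : ∀ w : PlacesOver E v, Valued.v (toPlace v w π) ^ j₀ < 1 := fun w => by
    have hne : Valued.v (toPlace v w π) ≠ 0 := valued_toPlace_uniformizer_ne_zero F E v hπ w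
    have h1 : Valued.v (toPlace v w π) < 1 := by
      refine lt_of_le_of_lt (valued_toPlace_uniformizer_le F E v hπ w) ?_
      rw [← WithZero.exp_zero]
      exact WithZero.exp_lt_exp.2 (by norm_num)
    calc Valued.v (toPlace v w π) ^ j₀ ≤ Valued.v (toPlace v w π) ^ (1 : ℤ) := zpow_le_zpow_right_of_le_one₀ (zero_lt_iff.2 hne) h1.le hj1
      _ < 1 := by rwa [zpow_one]
  have hdetA : (1 + toLocalRing E v z • Matrix.single a b e).det = if a = b then 1 + toLocalRing E v z * e else 1 := by
    rw [Matrix.smul_single, smul_eq_mul, det_one_add_single]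
  have hv1 : ∀ w : PlacesOver E v, Valued.v ((1 + toLocalRing E v z • Matrix.single a b e).det w) = 1 := fun w => by
    rw [hdetA]
    split_ifs
    · rw [Pi.add_apply, Pi.one_apply]
      exact Valuation.map_one_add_of_lt _ ((hze w).trans_lt (hlt w))
    · rw [Pi.one_apply, map_one]
  have hvsub : ∀ w : PlacesOver E v, Valued.v ((1 + toLocalRing E v z • Matrix.single a b e).det w - 1) ≤ Valued.v (toPlace v w π) ^ j₀ := fun w => by
    rw [hdetA]
    split_ifs
    · rw [Pi.add_apply, Pi.one_apply, add_sub_cancel_left]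
      exact hze w
    · rw [Pi.one_apply, sub_self, map_zero]
      exact zero_le
  -- `y := det A⁻¹`: `y · det A = 1`, so `|y|_{w′} = 1` and `|y − 1|_{w′} = |det A − 1|_{w′}`
  have hy : (1 + toLocalRing E v z • Matrix.single a b e)⁻¹.det * (1 + toLocalRing E v z • Matrix.single a b e).det = 1 :=
    Matrix.det_nonsing_inv_mul_det _ hdet
  have hyw : ∀ w : PlacesOver E v, (1 + toLocalRing E v z • Matrix.single a b e)⁻¹.det w * (1 + toLocalRing E v z • Matrix.single a b e).det w = 1 :=
    fun w => by rw [← Pi.mul_apply, hy, Pi.one_apply]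
  have hyv1 : ∀ w : PlacesOver E v, Valued.v ((1 + toLocalRing E v z • Matrix.single a b e)⁻¹.det w) = 1 := fun w => by
    have h := congrArg Valued.v (hyw w)
    rw [map_mul, hv1 w, mul_one, map_one] at h
    exact h
  have hysub : ∀ w : PlacesOver E v, Valued.v ((1 + toLocalRing E v z • Matrix.single a b e)⁻¹.det w - 1) ≤ Valued.v (toPlace v w π) ^ j₀ := fun w => by
    have h : (1 + toLocalRing E v z • Matrix.single a b e)⁻¹.det w - 1 =
        (1 + toLocalRing E v z • Matrix.single a b e)⁻¹.det w * (1 - (1 + toLocalRing E v z • Matrix.single a b e).det w) := by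
      rw [mul_sub, mul_one, hyw w]
    rw [h, map_mul, hyv1 w, one_mul, Valuation.map_sub_swap]
    exact hvsub w
  -- `det(blkD) = σ(det A⁻¹)`; its `w`-component: valuation `1`, and `≡ 1` within `|ϖ_w|^{cχ w}`
  have hdetD : (blkD (matA F E c v n q)).det = conjLocal E c v (1 + toLocalRing E v z • Matrix.single a b e)⁻¹.det := by
    rw [hDq, Matrix.det_conj' ((Matrix.isUnit_iff_isUnit_det _).2 hT), Matrix.det_transpose, ← RingHom.mapMatrix_apply, ← RingHom.map_det]
  have h2 : ∀ w : PlacesOver E v, Valued.v ((blkD (matA F E c v n q)).det w) = 1 := fun w => by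
    rw [hdetD, valued_conjLocal_apply F E c v]
    exact hyv1 _
  have h1 : ∀ w : PlacesOver E v, Valued.v ((blkD (matA F E c v n q)).det w - 1) ≤ Valued.v (ϖ w) ^ cχ w := fun w => by
    have hsub : (blkD (matA F E c v n q)).det w - 1 = conjLocal E c v ((1 + toLocalRing E v z • Matrix.single a b e)⁻¹.det - 1) w := by
      rw [hdetD, map_sub, map_one, Pi.sub_apply, Pi.one_apply]
    rw [hsub, valued_conjLocal_apply F E c v, Pi.sub_apply, Pi.one_apply]
    set w' : PlacesOver E v := ⟨c⁻¹ • w.1, under_inv_smul_eq c w⟩ with hw'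
    have hne : Valued.v (toPlace v w' π) ≠ 0 := valued_toPlace_uniformizer_ne_zero F E v hπ w'
    have hcw : (cχ w : ℤ) ≤ j₀ := by have := hsum w; omega
    calc Valued.v ((1 + toLocalRing E v z • Matrix.single a b e)⁻¹.det w' - 1) ≤ Valued.v (toPlace v w' π) ^ j₀ := hysub w'
      _ ≤ Valued.v (toPlace v w' π) ^ (cχ w : ℤ) :=
          zpow_le_zpow_right_of_le_one₀ (zero_lt_iff.2 hne) (valued_toPlace_uniformizer_le_one F E v hπ w') hcw
      _ = Valued.v (toPlace v w' π) ^ cχ w := zpow_natCast _ _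
      _ ≤ WithZero.exp (-1 : ℤ) ^ cχ w := pow_le_pow_left₀ zero_le (valued_toPlace_uniformizer_le F E v hπ w') _
      _ = Valued.v (ϖ w) ^ cχ w := by rw [hϖ w]
  refine ⟨q, hC, hB, hAq, ?_, ?_, ?_⟩
  · rw [hDinv]
    exact leviD_inv_one_add_smul F E c v n hT₀d z _
  · -- `χ_v(det_Δ(w_Δ q w_Δ)) = 1`
    unfold chiDet
    refine Finset.prod_eq_one fun w _ => ?_
    rw [detDelta_weylDelta_conj F E c v n hJD hC hB w]
    by_cases hx : IsUnit ((blkD (matA F E c v n q)).det w)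
    · rw [dif_pos hx]; exact hχc w _ hx (h1 w) (h2 w)
    · rw [dif_neg hx]
  · -- `|det_Δ(w_Δ q w_Δ)|_v = 1`
    unfold absDetDelta
    refine Finset.prod_eq_one fun w _ => ?_
    rw [detDelta_weylDelta_conj F E c v n hJD hC hB w]
    exact norm_eq_one_of_v_eq_one E w.1 (h2 w)

end Summit.HodgeConjecture.HodgeConjecture.Cruxes.HLiu418.K2LiuLocalLeviSupplyExplicit

end
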